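import Summits.FinalStateConjecture.FinalStateConjecture.Theorems.EIHFluxBalanceInertialRecessionPullback

/-!
# Route EIHFluxBalance — `InertialRecession`: the hole chart is a late-time chart

Helper file for the crux `stmt-FinalStateConjecture-10166`
(`Summit.FinalStateConjecture.FinalStateConjecture.Theses.EIHFluxBalance.InertialRecession`).

The clause `isLateChart` of `FinalStateDecomposition` for the re-charted hole charts `ψ = Φ ∘ A`
(`A` an open embedding of `E4` mapping the whole model domain into the late part of the lab chart's
domain, as delivered by `hole_chart_package`): `ψ` restricted to ANY open subset of the model domain
— in particular to every late region — is an open embedding, since it factors as the lab chart's late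
restriction (an open embedding by the crux hypothesis) after the open embedding induced by `A`
(`isOpenEmbedding_restrict_comp_of_isOpenEmbedding'`, registered form unprimed); smoothness is
`contMDiff_comp_smooth` of `…Pullback`. [folklore]
-/

noncomputable section

open scoped Topology Manifold ContDiff
open Filter Set Function TopologicalSpace Literature.Geometry.Lorentzian

namespace Summit.FinalStateConjecture.FinalStateConjecture.Theorems

/-- **Re-charted charts are open embeddings on open subsets.** Let `Φ : U → M` be an open embedding
on the late region `{x⁰ > τ₀}` of a lab background `B` (domain `U`, time `x⁰`), `A : E4 → E4` an open
embedding with `A(Ω) ⊆ U ∩ {x⁰ > τ₀}` on the domain `Ω` of a background `K`, and `ψ = Φ ∘ A` on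
`Ω`. Then `ψ` restricted to any open `S ⊆ Ω` is an open embedding. [folklore] -/
theorem isOpenEmbedding_restrict_comp_of_isOpenEmbedding' {M : Type*} [TopologicalSpace M]
    (B K : ModelBackground) (htime : ∀ x, B.time x = x 0) {Φ : B.domain → M} {τ₀ : ℝ}
    (hΦ : Topology.IsOpenEmbedding ((B.lateRegion τ₀).restrict Φ)) {A : E4 → E4} (hA : Topology.IsOpenEmbedding A)
    (hAU : ∀ x ∈ K.domain, A x ∈ B.domain) (hlate : ∀ x ∈ K.domain, τ₀ < A x 0)
    {ψ : K.domain → M} (hψ : ∀ x, ψ x = Φ ⟨A x.1, hAU x.1 x.2⟩) {S : Set K.domain} (hS : IsOpen S) :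
    Topology.IsOpenEmbedding (S.restrict ψ) := by
  have hc0 : Continuous fun y : E4 ↦ y 0 := PiLp.continuous_apply 2 _ 0
  have hLB : IsOpen (B.lateRegion τ₀) := by
    have : B.lateRegion τ₀ = {x | τ₀ < x.1 0} := by
      ext x
      rw [ModelBackground.mem_lateRegion, htime]
      rfl
    rw [this]
    exact isOpen_lt continuous_const (hc0.comp continuous_subtype_val)
  -- the induced map `S → {x⁰ > τ₀}`
  have hmem : ∀ x : S, (⟨A x.1.1, hAU x.1.1 x.1.2⟩ : B.domain) ∈ B.lateRegion τ₀ := by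
    intro x
    rw [ModelBackground.mem_lateRegion, htime]
    exact hlate x.1.1 x.1.2
  let j : S → B.lateRegion τ₀ := fun x ↦ ⟨⟨A x.1.1, hAU x.1.1 x.1.2⟩, hmem x⟩
  have hg0 : Topology.IsOpenEmbedding (fun y : B.lateRegion τ₀ ↦ (y.1.1 : E4)) :=
    B.domain.isOpen.isOpenEmbedding_subtypeVal.comp hLB.isOpenEmbedding_subtypeVal
  have hg1 : Topology.IsOpenEmbedding (fun x : S ↦ A (x.1.1 : E4)) :=
    hA.comp (K.domain.isOpen.isOpenEmbedding_subtypeVal.comp hS.isOpenEmbedding_subtypeVal)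
  have hj : Topology.IsOpenEmbedding j := Topology.IsOpenEmbedding.of_comp j hg0 hg1
  have heq : S.restrict ψ = (B.lateRegion τ₀).restrict Φ ∘ j := by
    funext x
    exact hψ x.1
  rw [heq]
  exact hΦ.comp hj

/-- The image of any subset of the model domain under the re-charted chart is the lab chart's image of
its `A`-image (bookkeeping for `image_subset` and the covering clauses). [folklore] -/
theorem image_restrict_comp_eq {M : Type*} (B K : ModelBackground) {Φ : B.domain → M} {A : E4 → E4}
    (hAU : ∀ x ∈ K.domain, A x ∈ B.domain) {ψ : K.domain → M}
    (hψ : ∀ x, ψ x = Φ ⟨A x.1, hAU x.1 x.2⟩) (S : Set K.domain) :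
    ψ '' S = Φ '' ((fun x : K.domain ↦ (⟨A x.1, hAU x.1 x.2⟩ : B.domain)) '' S) := by
  rw [Set.image_image]
  exact Set.image_congr fun x _ ↦ hψ x

/-- Registered sub-goal form (stub `isOpenEmbedding_restrict_comp_of_isOpenEmbedding` of the crux
item) of `isOpenEmbedding_restrict_comp_of_isOpenEmbedding'`. [folklore] -/
theorem isOpenEmbedding_restrict_comp_of_isOpenEmbedding : open Literature.Geometry.Lorentzian in ∀ {M : Type*} [TopologicalSpace M] (B K : ModelBackground), (∀ x, B.time x = x 0) → ∀ {Φ : B.domain → M} {τ₀ : ℝ}, Topology.IsOpenEmbedding ((B.lateRegion τ₀).restrict Φ) → ∀ {A : E4 → E4}, Topology.IsOpenEmbedding A → ∀ (hAU : ∀ x ∈ K.domain, A x ∈ B.domain), (∀ x ∈ K.domain, τ₀ < A x 0) → ∀ {ψ : K.domain → M}, (∀ x, ψ x = Φ ⟨A x.1, hAU x.1 x.2⟩) → ∀ {S : Set K.domain}, IsOpen S → Topology.IsOpenEmbedding (S.restrict ψ) :=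
  fun B K htime _ _ hΦ _ hA hAU hlate _ hψ _ hS ↦
    isOpenEmbedding_restrict_comp_of_isOpenEmbedding' B K htime hΦ hA hAU hlate hψ hS

end Summit.FinalStateConjecture.FinalStateConjecture.Theorems

end
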